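import Mathlib
import HarnessLib

/-!
# The de-transport of a window function is Möbius inversion

Helper file (`--supports stmt-RiemannHypothesis-0098`), elementary, no definitions.  Seat rh-explicit-weil-5 gen14
(file of record `HOME/rh-explicit-weil-5/WEIL5-XFOLD.md` §5E, gen13: "exact de-transport of the minimiser").

Context (documentation only).  The near-null vectors of the compressed Weil form on the window `[-a, a]` are read through
the *window relation* `u(x) = e^{x/2} Σ_{m ≤ M} S(m e^{x-a})` (`M = ⌊e^{2a}⌋`, `S` supported in `(0, 1]`: the dilate `m` is
alive on `x ≤ a - log m`).  Gen13 recovered `S` on `(1/μ, 1]` from `u` by a triangular recursion solved numerically from the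
top interval downward.  This file shows that the recursion has a CLOSED FORM: writing `T(w) := e^{-(a + log w)/2} u(a + log w)`
(`= w^{-1/2} e^{-a/2} u(a + log w)`), for every `v ∈ (1/(M+1), 1]`

  `S(v) = Σ_{n ≤ 1/v} μ(n) · T(n v)`                                                      (`deTransport_eq_moebius_sum`)

— the generalized Möbius inversion of Hardy–Wright, Theorem 268 (`G(x) = Σ_{n ≤ x} F(x/n)` for all `x ≥ 1` iff
`F(x) = Σ_{n ≤ x} μ(n) G(x/n)`), here proved in the direction needed and in the local form (the hypothesis is only used at
the points `x/n`).  Consequently the interior profile `S̃` of a section is an explicit finite signed combination of the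
section's own samples at the dilate points `x = a + log(n v)`, and two profiles with the same window function agree on
`(1/(M+1), 1]` (`deTransport_unique`).

Contents:
* `sum_moebius_mul_sum_floor_div`   : `Σ_{n ≤ N} μ(n) Σ_{m ≤ N/n} h(n m) = h(1)` (`N ≥ 1`; the hyperbola re-indexing +
                                       `μ * ζ = 1`);
* `moebius_inversion_floor`          : Hardy–Wright 268, local form: if `G(x/n) = Σ_{m ≤ ⌊x/n⌋} F(x/(n m))` for every
                                       `1 ≤ n ≤ ⌊x⌋` then `F(x) = Σ_{n ≤ ⌊x⌋} μ(n) G(x/n)` (`x ≥ 1`);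
* `windowSum_eq_floor_sum`           : under the support condition the window sum `Σ_{m ≤ M} S(m w)` equals `Σ_{m ≤ ⌊1/w⌋} S(m w)`
                                       whenever `⌊1/w⌋ ≤ M`;
* `deTransport_eq_moebius_sum`       : the closed form above;
* `deTransport_unique`               : uniqueness of the de-transport on `(1/(M+1), 1]`;
* `deTransport_top_interval`         : on `(1/2, 1]` only `m = 1` is alive: `S(v) = e^{-(a + log v)/2} u(a + log v)`.

Standard axioms only; no `sorry`.
-/

set_option linter.dupNamespace false
set_option autoImplicit false

noncomputable section

open Finset ArithmeticFunction Real
open scoped ArithmeticFunction.Moebius ArithmeticFunction.zeta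

namespace Summit.RiemannHypothesis.RiemannHypothesis.Theorems.WeilDeTransportMoebius

/-- `Σ_{d ∣ k} μ(d)`, cast into a ring, is the indicator of `k = 1`. -/
theorem sum_divisors_moebius_cast {R : Type*} [Ring R] (k : ℕ) :
    ∑ d ∈ k.divisors, ((μ d : ℤ) : R) = if k = 1 then 1 else 0 := by
  have h : (∑ d ∈ k.divisors, (μ d : ℤ)) = if k = 1 then 1 else 0 := by
    rw [← coe_mul_zeta_apply, moebius_mul_coe_zeta, one_apply]
  have := congrArg (fun z : ℤ => (z : R)) h
  simpa [Int.cast_sum] using this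

/-- THE HYPERBOLA RE-INDEXING WITH MÖBIUS WEIGHTS: for `N ≥ 1` and any `h : ℕ → R`,
`Σ_{n ≤ N} μ(n) Σ_{m ≤ N/n} h(n m) = h(1)` (pairs `(n, m)` with `n m ≤ N` grouped by `k = n m`; `Σ_{d ∣ k} μ(d) = [k = 1]`). -/
theorem sum_moebius_mul_sum_floor_div {R : Type*} [CommRing R] (h : ℕ → R) {N : ℕ} (hN : 1 ≤ N) :
    ∑ n ∈ Ioc 0 N, ((μ n : ℤ) : R) * ∑ m ∈ Ioc 0 (N / n), h (n * m) = h 1 := by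
  classical
  -- step 1: write the double sum over the filtered product set {(n, m) ∈ [1,N]² : n m ≤ N}
  have step1 : ∑ n ∈ Ioc 0 N, ((μ n : ℤ) : R) * ∑ m ∈ Ioc 0 (N / n), h (n * m)
      = ∑ x ∈ (Ioc 0 N ×ˢ Ioc 0 N).filter (fun x => x.1 * x.2 ≤ N), ((μ x.1 : ℤ) : R) * h (x.1 * x.2) := by
    rw [sum_filter, sum_product]
    refine sum_congr rfl fun n hn => ?_
    rw [mem_Ioc] at hn
    rw [mul_sum, ← sum_filter]
    congr 1
    ext m
    simp only [mem_Ioc, mem_filter]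
    constructor
    · rintro ⟨hm0, hm⟩
      refine ⟨⟨hm0, le_trans hm (Nat.div_le_self _ _)⟩, ?_⟩
      calc n * m ≤ n * (N / n) := Nat.mul_le_mul_left _ hm
        _ ≤ N := Nat.mul_div_le N n
    · rintro ⟨⟨hm0, -⟩, hnm⟩
      exact ⟨hm0, (Nat.le_div_iff_mul_le hn.1).mpr (by simpa [mul_comm] using hnm)⟩
  -- step 2: group by the value k = n m ∈ [1, N]
  have step2 : ∑ x ∈ (Ioc 0 N ×ˢ Ioc 0 N).filter (fun x => x.1 * x.2 ≤ N), ((μ x.1 : ℤ) : R) * h (x.1 * x.2)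
      = ∑ k ∈ Ioc 0 N, ∑ x ∈ (Ioc 0 N ×ˢ Ioc 0 N).filter (fun x => x.1 * x.2 = k), ((μ x.1 : ℤ) : R) * h (x.1 * x.2) := by
    rw [sum_filter]
    simp_rw [sum_filter]
    rw [sum_comm]
    refine sum_congr rfl fun x hx => ?_
    rw [mem_product, mem_Ioc, mem_Ioc] at hx
    by_cases hle : x.1 * x.2 ≤ N
    · rw [if_pos hle, sum_ite_eq (Ioc 0 N) (x.1 * x.2), if_pos]
      exact mem_Ioc.mpr ⟨Nat.mul_pos hx.1.1 hx.2.1, hle⟩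
    · rw [if_neg hle]
      symm
      refine sum_eq_zero fun k hk => ?_
      rw [mem_Ioc] at hk
      rw [if_neg]
      rintro rfl
      exact hle hk.2
  -- step 3: on the antidiagonal of k the summand is μ(n) h(k); sum over divisors
  have step3 : ∀ k ∈ Ioc 0 N,
      ∑ x ∈ (Ioc 0 N ×ˢ Ioc 0 N).filter (fun x => x.1 * x.2 = k), ((μ x.1 : ℤ) : R) * h (x.1 * x.2)
        = (if k = 1 then 1 else 0) * h k := by
    intro k hk
    rw [mem_Ioc] at hk
    rw [← Nat.divisorsAntidiagonal_eq_prod_filter_of_le hk.1.ne' hk.2]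
    have : ∑ x ∈ k.divisorsAntidiagonal, ((μ x.1 : ℤ) : R) * h (x.1 * x.2)
        = ∑ x ∈ k.divisorsAntidiagonal, ((μ x.1 : ℤ) : R) * h k := by
      refine sum_congr rfl fun x hx => ?_
      rw [Nat.mem_divisorsAntidiagonal] at hx
      rw [hx.1]
    rw [this, ← sum_mul, Nat.sum_divisorsAntidiagonal (f := fun i _ => ((μ i : ℤ) : R)),
      sum_divisors_moebius_cast]
  rw [step1, step2, sum_congr rfl step3]
  simp_rw [ite_mul, one_mul, zero_mul]
  rw [sum_ite_eq' (Ioc 0 N) 1, if_pos (mem_Ioc.mpr ⟨Nat.one_pos, hN⟩)]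

/-- HARDY–WRIGHT THEOREM 268 (generalized Möbius inversion), LOCAL FORM.  Let `x ≥ 1`.  If
`G(x/n) = Σ_{m ≤ ⌊x/n⌋} F((x/n)/m)` for every `1 ≤ n ≤ ⌊x⌋`, then `F(x) = Σ_{n ≤ ⌊x⌋} μ(n) G(x/n)`. -/
theorem moebius_inversion_floor {R : Type*} [CommRing R] (F G : ℝ → R) {x : ℝ} (hx : 1 ≤ x)
    (hG : ∀ n ∈ Ioc 0 ⌊x⌋₊, G (x / n) = ∑ m ∈ Ioc 0 ⌊x / n⌋₊, F (x / n / m)) :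
    F x = ∑ n ∈ Ioc 0 ⌊x⌋₊, ((μ n : ℤ) : R) * G (x / n) := by
  have hN : 1 ≤ ⌊x⌋₊ := Nat.one_le_iff_ne_zero.mpr (by
    intro h0; have := (Nat.floor_eq_zero.mp h0); linarith)
  have key := sum_moebius_mul_sum_floor_div (R := R) (fun k : ℕ => F (x / k)) hN
  rw [Nat.cast_one, div_one] at key
  rw [← key]
  refine sum_congr rfl fun n hn => ?_
  rw [hG n hn, Nat.floor_div_natCast]
  congr 1
  refine sum_congr rfl fun m _ => ?_
  rw [Nat.cast_mul, div_div]

/-- Under the support condition `S(w) = 0` for `w > 1`, the window sum over the dilates `m ≤ M` at a point `w > 0` with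
`⌊1/w⌋ ≤ M` reduces to the dilates that are alive there: `Σ_{m ≤ M} S(m w) = Σ_{m ≤ ⌊1/w⌋} S(m w)`. -/
theorem windowSum_eq_floor_sum (S : ℝ → ℝ) (hS : ∀ w, 1 < w → S w = 0) {M : ℕ} {w : ℝ} (hw : 0 < w)
    (hMw : ⌊1 / w⌋₊ ≤ M) :
    ∑ m ∈ Ioc 0 M, S (m * w) = ∑ m ∈ Ioc 0 ⌊1 / w⌋₊, S (m * w) := by
  symm
  refine sum_subset (fun m hm => ?_) (fun m hmM hm => ?_)
  · rw [mem_Ioc] at hm ⊢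
    exact ⟨hm.1, le_trans hm.2 hMw⟩
  · rw [mem_Ioc] at hmM hm
    have hlt : ⌊1 / w⌋₊ < m := by
      by_contra hle; exact hm ⟨hmM.1, not_lt.mp hle⟩
    have : 1 / w < m := Nat.lt_of_floor_lt hlt
    refine hS _ ?_
    rwa [div_lt_iff₀ hw] at this

/-- THE DE-TRANSPORT IS MÖBIUS INVERSION.  Let `u` satisfy the window relation
`u(x) = e^{x/2} Σ_{m ≤ M} S(m e^{x-a})` for `x ≤ a`, with `S(w) = 0` for `w > 1`.  Then for every `v` with
`1/(M+1) < v ≤ 1`,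
`S(v) = Σ_{n ≤ ⌊1/v⌋} μ(n) · e^{-(a + log(n v))/2} · u(a + log(n v))`
— the profile on `(1/(M+1), 1]` is an explicit Möbius sum of the window function's samples at the dilate points. -/
theorem deTransport_eq_moebius_sum (u S : ℝ → ℝ) (a : ℝ) (M : ℕ)
    (hu : ∀ x, x ≤ a → u x = Real.exp (x / 2) * ∑ m ∈ Ioc 0 M, S (m * Real.exp (x - a)))
    (hS : ∀ w, 1 < w → S w = 0) {v : ℝ} (hv : 1 / ((M : ℝ) + 1) < v) (hv1 : v ≤ 1) :
    S v = ∑ n ∈ Ioc 0 ⌊1 / v⌋₊,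
      (μ n : ℝ) * (Real.exp (-(a + Real.log (n * v)) / 2) * u (a + Real.log (n * v))) := by
  have hM1 : (0 : ℝ) < (M : ℝ) + 1 := by positivity
  have hv0 : 0 < v := lt_trans (by positivity) hv
  -- apply Hardy–Wright 268 with x = 1/v, F(y) = S(1/y), G(y) = e^{-(a + log(1/y))/2} u(a + log(1/y))
  have hx : 1 ≤ 1 / v := by rw [le_div_iff₀ hv0]; linarith
  have main := moebius_inversion_floor (R := ℝ) (fun y => S (1 / y))
    (fun y => Real.exp (-(a + Real.log (1 / y)) / 2) * u (a + Real.log (1 / y))) hx ?_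
  · -- unpack
    calc S v = (fun y : ℝ => S (1 / y)) (1 / v) := by simp only [one_div_one_div]
      _ = _ := main
      _ = _ := by
        refine sum_congr rfl fun n hn => ?_
        rw [mem_Ioc] at hn
        have hn0 : (0 : ℝ) < n := by exact_mod_cast hn.1
        have e1 : (1 / v) / (n : ℝ) = 1 / (n * v) := by rw [div_div, mul_comm]
        simp only [e1, one_div_one_div]
  · -- verify the hypothesis of 268 at the points x/n = 1/(n v): the window relation at x = a + log(n v)
    intro n hn
    rw [mem_Ioc] at hn
    have hn0 : (0 : ℝ) < n := by exact_mod_cast hn.1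
    have hnv0 : 0 < (n : ℝ) * v := mul_pos hn0 hv0
    -- n v ≤ 1 because n ≤ ⌊1/v⌋
    have hnv1 : (n : ℝ) * v ≤ 1 := by
      have : (n : ℝ) ≤ 1 / v := le_trans (by exact_mod_cast hn.2) (Nat.floor_le (by positivity))
      rwa [le_div_iff₀ hv0] at this
    -- the sample point lies in the window
    set x := a + Real.log (n * v) with hxdef
    have hxa : x ≤ a := by
      have : Real.log (n * v) ≤ 0 := Real.log_nonpos hnv0.le hnv1
      linarith
    have hexp : Real.exp (x - a) = n * v := by
      rw [hxdef, add_sub_cancel_left, Real.exp_log hnv0]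
    -- ⌊1/(n v)⌋ ≤ M since n v > 1/(M+1)
    have hfl : ⌊1 / ((n : ℝ) * v)⌋₊ ≤ M := by
      have h1 : 1 / ((n : ℝ) * v) < (M : ℝ) + 1 := by
        rw [div_lt_iff₀ hnv0]
        have : 1 / ((M : ℝ) + 1) < n * v := lt_of_lt_of_le hv (by nlinarith [hn0, hv0, show (1:ℝ) ≤ n by exact_mod_cast hn.1])
        rw [div_lt_iff₀ hM1] at this
        linarith
      have : ⌊1 / ((n : ℝ) * v)⌋₊ < M + 1 := (Nat.floor_lt (by positivity)).mpr (by exact_mod_cast h1)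
      omega
    have hwin := hu x hxa
    rw [hexp] at hwin
    rw [windowSum_eq_floor_sum S hS hnv0 hfl] at hwin
    -- now rewrite G(x/n) and the F-sum
    have e1 : (1 / v) / (n : ℝ) = 1 / (n * v) := by rw [div_div, one_div, one_div, mul_comm]
    simp only [e1, one_div_one_div]
    have e2 : Real.exp (-(a + Real.log (n * v)) / 2) * u (a + Real.log (n * v))
        = ∑ m ∈ Ioc 0 ⌊1 / ((n : ℝ) * v)⌋₊, S (m * (n * v)) := by
      rw [← hxdef, hwin, ← mul_assoc, ← Real.exp_add]
      have : -x / 2 + x / 2 = 0 := by ring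
      rw [this, Real.exp_zero, one_mul]
    rw [e2]
    refine sum_congr rfl fun m hm => ?_
    rw [mem_Ioc] at hm
    have hm0 : (0 : ℝ) < m := by exact_mod_cast hm.1
    congr 1
    field_simp

/-- UNIQUENESS OF THE DE-TRANSPORT: two profiles supported in `(0, 1]` with the same window function on `x ≤ a` agree on
`(1/(M+1), 1]`. -/
theorem deTransport_unique (u S₁ S₂ : ℝ → ℝ) (a : ℝ) (M : ℕ)
    (hu₁ : ∀ x, x ≤ a → u x = Real.exp (x / 2) * ∑ m ∈ Ioc 0 M, S₁ (m * Real.exp (x - a)))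
    (hu₂ : ∀ x, x ≤ a → u x = Real.exp (x / 2) * ∑ m ∈ Ioc 0 M, S₂ (m * Real.exp (x - a)))
    (hS₁ : ∀ w, 1 < w → S₁ w = 0) (hS₂ : ∀ w, 1 < w → S₂ w = 0) {v : ℝ} (hv : 1 / ((M : ℝ) + 1) < v)
    (hv1 : v ≤ 1) : S₁ v = S₂ v := by
  rw [deTransport_eq_moebius_sum u S₁ a M hu₁ hS₁ hv hv1, deTransport_eq_moebius_sum u S₂ a M hu₂ hS₂ hv hv1]

/-- THE TOP INTERVAL: on `(1/2, 1]` only the dilate `m = 1` is alive, so `S(v) = e^{-(a + log v)/2} u(a + log v)` there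
(`M ≥ 1`) — the starting point of gen13's downward recursion. -/
theorem deTransport_top_interval (u S : ℝ → ℝ) (a : ℝ) (M : ℕ) (hM : 1 ≤ M)
    (hu : ∀ x, x ≤ a → u x = Real.exp (x / 2) * ∑ m ∈ Ioc 0 M, S (m * Real.exp (x - a)))
    (hS : ∀ w, 1 < w → S w = 0) {v : ℝ} (hv : 1 / 2 < v) (hv1 : v ≤ 1) :
    S v = Real.exp (-(a + Real.log v) / 2) * u (a + Real.log v) := by
  have hv' : 1 / ((M : ℝ) + 1) < v := by
    refine lt_of_le_of_lt ?_ hv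
    have : (2 : ℝ) ≤ (M : ℝ) + 1 := by
      have : (1 : ℝ) ≤ M := by exact_mod_cast hM
      linarith
    exact one_div_le_one_div_of_le (by norm_num) this
  have hfl : ⌊1 / v⌋₊ = 1 := by
    have hv0 : 0 < v := by linarith
    rw [Nat.floor_eq_iff (by positivity)]
    constructor
    · rw [Nat.cast_one, le_div_iff₀ hv0]; linarith
    · rw [div_lt_iff₀ hv0]; push_cast; linarith
  rw [deTransport_eq_moebius_sum u S a M hu hS hv' hv1, hfl]
  simp

end Summit.RiemannHypothesis.RiemannHypothesis.Theorems.WeilDeTransportMoebius
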